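import Summits.BirchSwinnertonDyer.BirchSwinnertonDyer.Theorems.PrintCf2RamifiedOffTYZGenusPeriodR2
import Summits.BirchSwinnertonDyer.BirchSwinnertonDyer.Theorems.PrintCf2RamifiedOffTYZVisibleGenerator
import Literature.NumberTheory.EllipticCurves.KramerDescentShaGProofs
import HarnessLib

/-!
# THE KUMMER CLASS OF THE GENUS PERIOD: `Z(lq) ∈ 2A(ℍ′) + tors` read as a pair of SQUARE CLASSES of `ℍ′_{lq}`, and LAW Z⁺
# (crux stmt-BirchSwinnertonDyer-20509 `RamifiedOffTYZOfFacts`, line `offtyz-v7`, LEAD cruxlead-20509 g28, lineage cycle 29)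

HONEST FRAMING (cell `bsd-print-cf2`, route `PrintCf2`; `--supports stmt-BirchSwinnertonDyer-20509`; theorems only, `def`-free, no named fact
introduced, no `sorry`).  BSD is not proved by any of this; no class is closed by this file; item 23431 (C⁺) and crux 20509 stay OPEN.

WHY.  Cycle 28 (g27, `…RedeiCellsR2`) left C⁺ on the two-prime sector R2 = {`n = lq` : `l ≡ 1`, `q ≡ 7 (mod 8)` primes, `(l/q) = 1`} as
LAW Z ∧ LAW V ∧ LAW S, with LAW Z the ONE-BIT empirical law «`Z(lq) ∈ 2A(ℍ′_{lq}) + tors ⟺ l = x² + 32y² ∧ [𝔭₂] ∈ Cl(ℚ(√−lq))⁴`».  The bit is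
the vanishing of the complete `2`-descent (Kummer) class of the genus period `Z(lq)` on TYZ's curve `A : Y² = X³ + 4X = X(X − 2i)(X + 2i)` over
`ℍ′_{lq} = ℚ(i, √l, √−q)`, read modulo the classes of `A(ℍ′)_tor ⊆ A[(1+i)³]` (Lemma 3.18).  THE CYCLE-29 INSTRUMENT (`zclass.py`, exact arithmetic
in `ℚ(i, √l, √−q)` over g17's `zperiod.py`; evidence `KUMMER-CLASS-R2-g28.md` on item 20509) NAMES THAT CLASS on all 122 census rows and on fresh
rows: with `π_l = a + bi` (`a² + b² = l`, the Gaussian prime) and `β_l = x + y√−q` (`x² + qy² = l·w²`, the Rédei generator of the cyclic quartic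
unramified extension of `ℚ(√−lq)`),
  **LAW Z⁺:  `[X(Z(lq))] = 1` and `[X(Z(lq)) − 2i] = [π_l]^{[S = −1]} · [β_l]^{[l ≠ x²+32y²]}` in `ℍ′^× / ⟨ℍ′^{×2}, i⟩`**
(`S = [2,l,q]` the Rédei symbol of g27; 0 exceptions).  So `Z(lq)` becomes `2`-divisible modulo torsion exactly over `ℍ′`, `ℍ′(√π_l)`, `ℍ′(√β_l)` or
`ℍ′(√(π_l β_l))` according to the cell — the U-road's target WITH ITS VALUE.  This file supplies the kernel side:

* §1 (fact-free, any `R ∈ A(ℍ′_n)`): ★ `twoDivisible_modTorsion_iff_kummer` — **`R ∈ 2A(ℍ′) + tors ⟺` some torsion `t` has the same two descent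
  components `[X − 2i]`, `[X]` as `R`** (Silverman X.1.4: the kernel of the complete `2`-descent map is `2A`).
* §2 (odd `n`, Lemma 3.18 displayed): `kummer_torsion_values` — the torsion classes are `([X],[X − 2i]) ∈ {(1,1), (1,[i]), ([i],[1+i]), ([i],[i(1+i)])}`;
  ★★ `twoDivisible_modTorsion_iff_sqClass` — **`R ∈ 2A(ℍ′) + tors ⟺ ([X(R)] = 1 ∧ [X(R) − 2i] ∈ {1, [i]}) ∨ ([X(R)] = [i] ∧ [X(R) − 2i] ∈ {[1+i], [i(1+i)]})`**;
  `twoDivisible_modTorsion_iff_sq` — the same in coordinates (`X·w`, `(X − 2i)·w′` squares).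
* §3 ★★ `twoDivisible_iff_cell_of_lawZPlus` — at a row where LAW Z⁺ holds in the displayed shape (`[X(Z)] = 1`, `[X(Z) − 2i] = [c]` or `[i·c]`,
  `c = π_l^{e₁} β_l^{e₂}`) and the classes `[π_l], [β_l], [π_l β_l]` avoid `{1, [i]}` (independence; instrument: 122/122), **`Z ∈ 2A(ℍ′) + tors ⟺
  e₁ = 0 ∧ e₂ = 0`** — LAW Z's bit is LAW Z⁺ read through §2; ★★ `levelTwo_of_lawZPlus_of_visible` — composed with g26's
  `GenusPeriodR2.levelTwo_iff_genusPeriod_not_twoDivisible_of_visible`: on a visible row (`X(h) ∉ 2ℚ^{×2}`) with `(e₁, e₂) ≠ (0, 0)`, C⁺ holds at `lq`.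

References: [cite: SilvermanAEC2009, Prop. X.1.4] (complete `2`-descent, kernel `= 2E`); [cite: Knapp1993, Thm. 4.2] (explicit halving);
[cite: TianYuanZhang2017, §3.1 (p0011 L53–L66), Lemma 3.16 (p0017 L98–L113), Lemma 3.18 (p0017 L152–L153)]; [cite: Redei1934] via g27's dictionary;
tree: `Literature/…/TwoDescent` (`twoDescentComponent_add`, `exists_add_self_of_twoDescentComponent_eq_one`), `…/KramerDescentShaGProofs`
(`sqClass_eq_of_mul_eq_square`), g16 `…VisibleGenerator` (`splitTwoTorsion_curveA`), g26 `…GenusPeriodR2`, `TianYuanZhang2017/CurveAFourTorsion`.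
-/

noncomputable section

open scoped Classical

open WeierstrassCurve WeierstrassCurve.Affine WeierstrassCurve.Affine.Point
  Literature.NumberTheory.EllipticCurves Literature.NumberTheory.EllipticCurves.Rank1Residual
  Summit.BirchSwinnertonDyer.Rank1Residual
  Literature.NumberTheory.EllipticCurves.TianYuanZhang2017
  Literature.NumberTheory.EllipticCurves.TianYuanZhang2017.W2
  Summit.BirchSwinnertonDyer.PrintCf2.VisibleGenerator

set_option autoImplicit false

namespace Summit.BirchSwinnertonDyer.PrintCf2.GenusPeriodKummer

variable {n : ℕ}

/-! ## §1 `2`-divisibility modulo torsion ⟺ the Kummer class is a torsion class (fact-free) -/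

/-- `A/ℍ′_n` is an elliptic curve (instance plumbing for the descent homomorphism). [folklore] -/
theorem isElliptic_curveA_baseChange (D : GenusPointData n) : (curveA.baseChange D.H).IsElliptic :=
  inferInstanceAs (curveA.map (algebraMap ℚ D.H)).IsElliptic

/-- The two descent components `[X − 2i]` (at `T = (2i,0)`) and `[X]` (at `T = (0,0)`) kill `2A(ℍ′_n)`: `δ(P + 2y) = δ(P)`.
[cite: SilvermanAEC2009, Prop. X.1.4] -/
theorem kummer_add_two_zsmul (D : GenusPointData n) (P y : APoint D.H) :
    twoDescentComponent (curveA.baseChange D.H).toAffine (2 * D.im) 0 (-(2 * D.im)) (P + (2 : ℤ) • y) =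
      twoDescentComponent (curveA.baseChange D.H).toAffine (2 * D.im) 0 (-(2 * D.im)) P ∧
    twoDescentComponent (curveA.baseChange D.H).toAffine 0 (2 * D.im) (-(2 * D.im)) (P + (2 : ℤ) • y) =
      twoDescentComponent (curveA.baseChange D.H).toAffine 0 (2 * D.im) (-(2 * D.im)) P := by
  haveI := isElliptic_curveA_baseChange D
  have h := splitTwoTorsion_curveA D
  refine ⟨?_, ?_⟩
  · rw [two_zsmul, twoDescentComponent_add h, twoDescentComponent_add h, SqUnits.mul_self, SqUnits.mul_one]
  · rw [two_zsmul, twoDescentComponent_add h.swap₁₂, twoDescentComponent_add h.swap₁₂, SqUnits.mul_self, SqUnits.mul_one]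

/-- ★ **`2`-DIVISIBILITY MODULO TORSION IS A STATEMENT ABOUT THE KUMMER CLASS** (any `R ∈ A(ℍ′_n)`, fact-free): `R − 2y` is torsion for some `y`
**iff** some torsion point `t` has the same complete `2`-descent classes `([X − 2i], [X])` as `R` (⟹: `t = R − 2y`; ⟸: `R − t` lies in the kernel
of the complete `2`-descent map, which is `2A(ℍ′_n)` by Silverman X.1.4). [cite: SilvermanAEC2009, Prop. X.1.4] [cite: Knapp1993, Thm. 4.2] -/
theorem twoDivisible_modTorsion_iff_kummer (D : GenusPointData n) (R : APoint D.H) :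
    (∃ y : APoint D.H, IsOfFinAddOrder (R - (2 : ℤ) • y)) ↔
      ∃ t : APoint D.H, IsOfFinAddOrder t ∧
        twoDescentComponent (curveA.baseChange D.H).toAffine (2 * D.im) 0 (-(2 * D.im)) R =
          twoDescentComponent (curveA.baseChange D.H).toAffine (2 * D.im) 0 (-(2 * D.im)) t ∧
        twoDescentComponent (curveA.baseChange D.H).toAffine 0 (2 * D.im) (-(2 * D.im)) R =
          twoDescentComponent (curveA.baseChange D.H).toAffine 0 (2 * D.im) (-(2 * D.im)) t := by
  haveI := isElliptic_curveA_baseChange D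
  have h := splitTwoTorsion_curveA D
  constructor
  · rintro ⟨y, hy⟩
    refine ⟨R - (2 : ℤ) • y, hy, ?_, ?_⟩
    · conv_lhs => rw [← sub_add_cancel R ((2 : ℤ) • y)]
      exact (kummer_add_two_zsmul D _ y).1
    · conv_lhs => rw [← sub_add_cancel R ((2 : ℤ) • y)]
      exact (kummer_add_two_zsmul D _ y).2
  · rintro ⟨t, ht, h1, h2⟩
    have e1 : twoDescentComponent (curveA.baseChange D.H).toAffine (2 * D.im) 0 (-(2 * D.im)) (R - t) = 1 := by
      rw [sub_eq_add_neg, twoDescentComponent_add h, twoDescentComponent_neg, ← h1, SqUnits.mul_self]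
    have e2 : twoDescentComponent (curveA.baseChange D.H).toAffine 0 (2 * D.im) (-(2 * D.im)) (R - t) = 1 := by
      rw [sub_eq_add_neg, twoDescentComponent_add h.swap₁₂, twoDescentComponent_neg, ← h2, SqUnits.mul_self]
    obtain ⟨Q, hQ⟩ := exists_add_self_of_twoDescentComponent_eq_one h (R - t) e1 e2
    refine ⟨Q, ?_⟩
    have : R - (2 : ℤ) • Q = t := by rw [two_zsmul, hQ]; abel
    rw [this]; exact ht

/-! ## §2 The torsion classes (odd `n`, Lemma 3.18): `([X], [X − 2i]) ∈ {(1,1), (1,[i]), ([i],[1+i]), ([i],[i(1+i)])}` -/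

/-- `[a] = [b]` with `a, b ≠ 0` ⟹ `a·b` is a square. [folklore] -/
theorem exists_sq_of_sqClass_eq {F : Type*} [Field F] {a b : F} (ha : a ≠ 0) (hb : b ≠ 0) (h : sqClass a = sqClass b) :
    ∃ s : F, a * b = s ^ 2 := by
  have h1 : sqClass (a * b) = 1 := by rw [sqClass_mul ha hb, h, SqUnits.mul_self]
  exact (sqClass_eq_one_iff (mul_ne_zero ha hb)).mp h1

/-- `[a] = [b]` ⟺ `a·b` is a square (`a, b ≠ 0`). [folklore] -/
theorem sqClass_eq_iff_exists_sq {F : Type*} [Field F] {a b : F} (ha : a ≠ 0) (hb : b ≠ 0) :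
    sqClass a = sqClass b ↔ ∃ s : F, a * b = s ^ 2 :=
  ⟨exists_sq_of_sqClass_eq ha hb, fun ⟨_, hs⟩ => KramerShaG.sqClass_eq_of_mul_eq_square ha hb hs⟩

/-- Small arithmetic in `ℍ′_n ∋ i`: `2i = (1+i)²`, `−2i = (i−1)²`, `(−8)·i = (2−2i)²`, `(−4i)·i = 2²`, `(2−2i)(1+i) = 2²`, `2·i = (1+i)²`,
`(−2−2i)·(i(1+i)) = 2²`, `(−2)·i = (i−1)²`. [folklore] -/
theorem im_arith (D : GenusPointData n) :
    2 * D.im = (1 + D.im) ^ 2 ∧ -(2 * D.im) = (D.im - 1) ^ 2 ∧ (-8 : D.H) * D.im = (2 - 2 * D.im) ^ 2 ∧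
      -(4 * D.im) * D.im = 2 ^ 2 ∧ (2 - 2 * D.im) * (1 + D.im) = 2 ^ 2 ∧ (2 : D.H) * D.im = (1 + D.im) ^ 2 ∧
      (-2 - 2 * D.im) * (D.im * (1 + D.im)) = 2 ^ 2 ∧ (-2 : D.H) * D.im = (D.im - 1) ^ 2 := by
  have him := D.im_sq
  refine ⟨?_, ?_, ?_, ?_, ?_, ?_, ?_, ?_⟩
  · linear_combination (-1 : D.H) * him
  · linear_combination (-1 : D.H) * him
  · linear_combination (-4 : D.H) * him
  · linear_combination (-4 : D.H) * him
  · linear_combination (-2 : D.H) * him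
  · linear_combination (-1 : D.H) * him
  · linear_combination (-2 * D.im - 4) * him
  · linear_combination (-1 : D.H) * him

/-- Non-vanishing of the constants `1+i`, `i−1`, `2−2i`, `−2−2i`, `i(1+i)` and `2 ≠ 2i`, `−2 ≠ 2i`, `−2i ≠ 2i`, `0 ≠ 2i` in `ℍ′_n`. [folklore] -/
theorem im_ne (D : GenusPointData n) :
    (1 + D.im ≠ 0) ∧ (D.im - 1 ≠ 0) ∧ (2 - 2 * D.im ≠ 0) ∧ (-2 - 2 * D.im ≠ 0) ∧ (D.im * (1 + D.im) ≠ 0) ∧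
      ((2 : D.H) ≠ 2 * D.im) ∧ ((-2 : D.H) ≠ 2 * D.im) ∧ (-(2 * D.im) ≠ 2 * D.im) ∧ ((0 : D.H) ≠ 2 * D.im) := by
  have him := D.im_sq
  have hi0 := P2.ThetaDescent.im_ne_zero D
  have h1 : 1 + D.im ≠ 0 := by
    intro h
    have : D.im = -1 := by linear_combination h
    rw [this] at him; norm_num at him
  have h2 : D.im - 1 ≠ 0 := by
    intro h
    have : D.im = 1 := by linear_combination h
    rw [this] at him; norm_num at him
  refine ⟨h1, h2, ?_, ?_, mul_ne_zero hi0 h1, ?_, ?_, ?_, ?_⟩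
  · intro h; apply h2; linear_combination (-1/2 : D.H) * h
  · intro h; apply h1; linear_combination (-1/2 : D.H) * h
  · intro h; apply h2; linear_combination (-1/2 : D.H) * h
  · intro h; apply h1; linear_combination (-1/2 : D.H) * h
  · intro h; apply hi0; linear_combination (-1/4 : D.H) * h
  · intro h; apply hi0; linear_combination (-1/2 : D.H) * h

/-- **Kummer classes of the `2`-torsion**: `(0,0) ↦ (1, 1)`, `(2i,0) ↦ (1, [i])`, `(−2i,0) ↦ (1, [i])` (components `([X], [X − 2i])`;
`[4] = [2i] = [−2i] = 1`, `[−8] = [−4i] = [i]` in `ℍ′ ∋ i`). [cite: SilvermanAEC2009, Prop. X.1.4] [cite: TianYuanZhang2017, Lemma 3.16 (p0017 L98–L113)] -/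
theorem kummer_two_torsion (D : GenusPointData n) :
    (twoDescentComponent (curveA.baseChange D.H).toAffine 0 (2 * D.im) (-(2 * D.im)) (tauOne : APoint D.H) = 1 ∧
      twoDescentComponent (curveA.baseChange D.H).toAffine (2 * D.im) 0 (-(2 * D.im)) (tauOne : APoint D.H) = 1) ∧
    (twoDescentComponent (curveA.baseChange D.H).toAffine 0 (2 * D.im) (-(2 * D.im)) (ptTwoI D.im D.im_sq) = 1 ∧
      twoDescentComponent (curveA.baseChange D.H).toAffine (2 * D.im) 0 (-(2 * D.im)) (ptTwoI D.im D.im_sq) = sqClass D.im) ∧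
    (twoDescentComponent (curveA.baseChange D.H).toAffine 0 (2 * D.im) (-(2 * D.im)) (ptNegTwoI D.im D.im_sq) = 1 ∧
      twoDescentComponent (curveA.baseChange D.H).toAffine (2 * D.im) 0 (-(2 * D.im)) (ptNegTwoI D.im D.im_sq) = sqClass D.im) := by
  have him := D.im_sq
  have hi0 := P2.ThetaDescent.im_ne_zero D
  obtain ⟨a1, a2, a3, a4, -, -, -, -⟩ := im_arith D
  obtain ⟨-, -, -, -, -, -, -, cm2i, c0⟩ := im_ne D
  refine ⟨⟨?_, ?_⟩, ⟨?_, ?_⟩, ⟨?_, ?_⟩⟩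
  · rw [tauOne, twoDescentComponent_some_of_eq _ rfl]
    rw [show ((0 : D.H) - 2 * D.im) * (0 - -(2 * D.im)) = 2 ^ 2 by linear_combination (-4 : D.H) * him, sqClass_sq]
  · rw [tauOne, twoDescentComponent_some_of_ne _ c0, zero_sub, a2, sqClass_sq]
  · rw [ptTwoI, twoDescentComponent_some_of_ne _ (mul_ne_zero two_ne_zero hi0), sub_zero, a1, sqClass_sq]
  · rw [ptTwoI, twoDescentComponent_some_of_eq _ rfl]
    rw [show (2 * D.im - 0) * (2 * D.im - -(2 * D.im)) = (-8 : D.H) by linear_combination (8 : D.H) * him]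
    exact KramerShaG.sqClass_eq_of_mul_eq_square (by norm_num) hi0 a3
  · rw [ptNegTwoI, twoDescentComponent_some_of_ne _ (neg_ne_zero.mpr (mul_ne_zero two_ne_zero hi0)), sub_zero, a2, sqClass_sq]
  · rw [ptNegTwoI, twoDescentComponent_some_of_ne _ cm2i]
    rw [show -(2 * D.im) - 2 * D.im = -(4 * D.im) by ring]
    exact KramerShaG.sqClass_eq_of_mul_eq_square (neg_ne_zero.mpr (mul_ne_zero (by norm_num) hi0)) hi0 a4

/-- **Kummer classes of `τ(½) = (2, 4)` and `[i]τ(½) = (−2, 4i)`**: `([2], [2 − 2i]) = ([i], [1+i])` and `([−2], [−2−2i]) = ([i], [i(1+i)])`.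
[cite: SilvermanAEC2009, Prop. X.1.4] [cite: TianYuanZhang2017, §3.2 (p0012 L12–L18)] -/
theorem kummer_tauHalf (D : GenusPointData n) :
    (twoDescentComponent (curveA.baseChange D.H).toAffine 0 (2 * D.im) (-(2 * D.im)) (tauHalf : APoint D.H) = sqClass D.im ∧
      twoDescentComponent (curveA.baseChange D.H).toAffine (2 * D.im) 0 (-(2 * D.im)) (tauHalf : APoint D.H) = sqClass (1 + D.im)) ∧
    (twoDescentComponent (curveA.baseChange D.H).toAffine 0 (2 * D.im) (-(2 * D.im)) (cmI D.im D.im_sq tauHalf) = sqClass D.im ∧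
      twoDescentComponent (curveA.baseChange D.H).toAffine (2 * D.im) 0 (-(2 * D.im)) (cmI D.im D.im_sq tauHalf) =
        sqClass (D.im * (1 + D.im))) := by
  have hi0 := P2.ThetaDescent.im_ne_zero D
  obtain ⟨-, -, -, -, a5, a6, a7, a8⟩ := im_arith D
  obtain ⟨n1, -, -, -, n5, c2, cm2, -, -⟩ := im_ne D
  have hneg2 : (-2 : D.H) ≠ 0 := by norm_num
  refine ⟨⟨?_, ?_⟩, ⟨?_, ?_⟩⟩
  · rw [tauHalf, twoDescentComponent_some_of_ne _ two_ne_zero, sub_zero]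
    exact KramerShaG.sqClass_eq_of_mul_eq_square two_ne_zero hi0 a6
  · rw [tauHalf, twoDescentComponent_some_of_ne _ c2]
    exact KramerShaG.sqClass_eq_of_mul_eq_square (sub_ne_zero.mpr c2) n1 a5
  · rw [tauHalf, cmI_some, twoDescentComponent_some_of_ne _ hneg2, sub_zero]
    exact KramerShaG.sqClass_eq_of_mul_eq_square hneg2 hi0 a8
  · rw [tauHalf, cmI_some, twoDescentComponent_some_of_ne _ cm2]
    exact KramerShaG.sqClass_eq_of_mul_eq_square (sub_ne_zero.mpr cm2) n5 a7

/-- **THE KUMMER CLASSES OF THE TORSION OF `A(ℍ′_n)`, `n` odd** (Lemma 3.18: `A(ℍ′_n)_tor ⊆ A[(1+i)³] = {O, (0,0), (±2i,0), (2,±4), (−2,±4i)}`):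
for every torsion `t`, the pair `([X(t)], [X(t) − 2i])` (descent components at `(0,0)` and at `(2i,0)`) is one of
`(1, 1)` (`t = O, (0,0)`), `(1, [i])` (`t = (±2i, 0)`), `([i], [1+i])` (`t = (2, ±4)`), `([i], [i(1+i)])` (`t = (−2, ±4i)`).
[cite: TianYuanZhang2017, Lemma 3.18 (p0017 L152–L153), Lemma 3.16 (p0017 L98–L113), §3.2 (p0012 L12–L18)] [cite: SilvermanAEC2009, Prop. X.1.4] -/
theorem kummer_torsion_values (D : GenusPointData n) (hodd : Odd n) (h318 : D.lemma318) {t : APoint D.H} (ht : IsOfFinAddOrder t) :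
    (twoDescentComponent (curveA.baseChange D.H).toAffine 0 (2 * D.im) (-(2 * D.im)) t = 1 ∧
        (twoDescentComponent (curveA.baseChange D.H).toAffine (2 * D.im) 0 (-(2 * D.im)) t = 1 ∨
          twoDescentComponent (curveA.baseChange D.H).toAffine (2 * D.im) 0 (-(2 * D.im)) t = sqClass D.im)) ∨
      (twoDescentComponent (curveA.baseChange D.H).toAffine 0 (2 * D.im) (-(2 * D.im)) t = sqClass D.im ∧
        (twoDescentComponent (curveA.baseChange D.H).toAffine (2 * D.im) 0 (-(2 * D.im)) t = sqClass (1 + D.im) ∨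
          twoDescentComponent (curveA.baseChange D.H).toAffine (2 * D.im) 0 (-(2 * D.im)) t = sqClass (D.im * (1 + D.im)))) := by
  obtain ⟨⟨t1a, t1b⟩, ⟨t2a, t2b⟩, ⟨t3a, t3b⟩⟩ := kummer_two_torsion D
  obtain ⟨⟨h1a, h1b⟩, ⟨h2a, h2b⟩⟩ := kummer_tauHalf D
  obtain ⟨-, h2t⟩ := h318.1 hodd t ht
  rcases h2t with h0 | h1
  · rcases TianYuanZhang2017.eq_of_two_nsmul_eq_zero D.im D.im_sq h0 with rfl | rfl | rfl | rfl
    · exact Or.inl ⟨twoDescentComponent_zero, Or.inl twoDescentComponent_zero⟩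
    · exact Or.inl ⟨t1a, Or.inl t1b⟩
    · exact Or.inl ⟨t2a, Or.inr t2b⟩
    · exact Or.inl ⟨t3a, Or.inr t3b⟩
  · rcases Summit.BirchSwinnertonDyer.Rank1Residual.P2.ThetaDescent.eq_of_two_nsmul_eq_tauOne D.im D.im_sq t h1 with
      rfl | rfl | rfl | rfl
    · exact Or.inr ⟨h1a, Or.inl h1b⟩
    · refine Or.inr ⟨?_, Or.inl ?_⟩ <;> rw [twoDescentComponent_neg]
      exacts [h1a, h1b]
    · exact Or.inr ⟨h2a, Or.inr h2b⟩
    · refine Or.inr ⟨?_, Or.inr ?_⟩ <;> rw [twoDescentComponent_neg]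
      exacts [h2a, h2b]

/-- The eight points `O, (0,0), (±2i,0), (2,±4), (−2,±4i)` used above ARE torsion (`4t = 0`). [cite: TianYuanZhang2017, Lemma 3.16 (p0017 L98–L113), §3.2 (p0012 L12–L18)] -/
theorem torsion_witnesses (D : GenusPointData n) :
    IsOfFinAddOrder (tauOne : APoint D.H) ∧ IsOfFinAddOrder (ptTwoI D.im D.im_sq) ∧
      IsOfFinAddOrder (tauHalf : APoint D.H) ∧ IsOfFinAddOrder (cmI D.im D.im_sq tauHalf) := by
  have key : ∀ {t : APoint D.H} (m : ℕ), 0 < m → m • t = 0 → IsOfFinAddOrder t := fun m hm h =>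
    isOfFinAddOrder_iff_nsmul_eq_zero.mpr ⟨m, hm, h⟩
  refine ⟨key 2 two_pos two_nsmul_tauOne, key 2 two_pos (two_nsmul_ptTwoI D.im D.im_sq), key 4 (by norm_num) four_nsmul_tauHalf,
    key 4 (by norm_num) ?_⟩
  rw [← map_nsmul, four_nsmul_tauHalf, _root_.map_zero]

/-- ★★ **`2`-DIVISIBILITY MODULO TORSION ⟺ THE KUMMER CLASS IS ONE OF FOUR**, `n` odd, Lemma 3.18 displayed: for any `R ∈ A(ℍ′_n)`,
**`R ∈ 2A(ℍ′_n) + tors ⟺ ([X(R)] = 1 ∧ [X(R) − 2i] ∈ {1, [i]}) ∨ ([X(R)] = [i] ∧ [X(R) − 2i] ∈ {[1+i], [i(1+i)]})`** (classes = the two descent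
components; for the genus period the instrument finds the first alternative on every R2 row: `[X(Z)] = 1`).
[cite: SilvermanAEC2009, Prop. X.1.4] [cite: TianYuanZhang2017, Lemma 3.18 (p0017 L152–L153), Lemma 3.16 (p0017 L98–L113)] -/
theorem twoDivisible_modTorsion_iff_sqClass (D : GenusPointData n) (hodd : Odd n) (h318 : D.lemma318) (R : APoint D.H) :
    (∃ y : APoint D.H, IsOfFinAddOrder (R - (2 : ℤ) • y)) ↔
      (twoDescentComponent (curveA.baseChange D.H).toAffine 0 (2 * D.im) (-(2 * D.im)) R = 1 ∧
          (twoDescentComponent (curveA.baseChange D.H).toAffine (2 * D.im) 0 (-(2 * D.im)) R = 1 ∨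
            twoDescentComponent (curveA.baseChange D.H).toAffine (2 * D.im) 0 (-(2 * D.im)) R = sqClass D.im)) ∨
        (twoDescentComponent (curveA.baseChange D.H).toAffine 0 (2 * D.im) (-(2 * D.im)) R = sqClass D.im ∧
          (twoDescentComponent (curveA.baseChange D.H).toAffine (2 * D.im) 0 (-(2 * D.im)) R = sqClass (1 + D.im) ∨
            twoDescentComponent (curveA.baseChange D.H).toAffine (2 * D.im) 0 (-(2 * D.im)) R = sqClass (D.im * (1 + D.im)))) := by
  rw [twoDivisible_modTorsion_iff_kummer]
  obtain ⟨⟨t1a, t1b⟩, ⟨t2a, t2b⟩, -⟩ := kummer_two_torsion D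
  obtain ⟨⟨h1a, h1b⟩, ⟨h2a, h2b⟩⟩ := kummer_tauHalf D
  obtain ⟨w1, w2, w3, w4⟩ := torsion_witnesses D
  constructor
  · rintro ⟨t, ht, e1, e2⟩
    rcases kummer_torsion_values D hodd h318 ht with ⟨f2, f1 | f1⟩ | ⟨f2, f1 | f1⟩
    · exact Or.inl ⟨e2.trans f2, Or.inl (e1.trans f1)⟩
    · exact Or.inl ⟨e2.trans f2, Or.inr (e1.trans f1)⟩
    · exact Or.inr ⟨e2.trans f2, Or.inl (e1.trans f1)⟩
    · exact Or.inr ⟨e2.trans f2, Or.inr (e1.trans f1)⟩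
  · rintro (⟨f2, f1 | f1⟩ | ⟨f2, f1 | f1⟩)
    · exact ⟨0, IsOfFinAddOrder.zero, by rw [f1, twoDescentComponent_zero], by rw [f2, twoDescentComponent_zero]⟩
    · exact ⟨ptTwoI D.im D.im_sq, w2, by rw [f1, t2b], by rw [f2, t2a]⟩
    · exact ⟨tauHalf, w3, by rw [f1, h1b], by rw [f2, h1a]⟩
    · exact ⟨cmI D.im D.im_sq tauHalf, w4, by rw [f1, h2b], by rw [f2, h2a]⟩

/-- **The same in coordinates**: for an affine `R = (X, Y) ∈ A(ℍ′_n)` with `X ≠ 0, 2i` (`n` odd, Lemma 3.18):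
`R ∈ 2A(ℍ′_n) + tors ⟺ (X ∈ ℍ′² ∧ (X − 2i ∈ ℍ′² ∨ i(X − 2i) ∈ ℍ′²)) ∨ (iX ∈ ℍ′² ∧ ((1+i)(X − 2i) ∈ ℍ′² ∨ i(1+i)(X − 2i) ∈ ℍ′²))` — the exact test
run by the instruments `zperiod.py` (g17) / `zclass.py` (g28) on `X = X(Z(lq)) ∈ ℚ(√l, √−q)`.
[cite: SilvermanAEC2009, Prop. X.1.4] [cite: KoblitzECMF1993, Ch. II §5, Theorem (p. 84)] [cite: TianYuanZhang2017, Lemma 3.18 (p0017 L152–L153)] -/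
theorem twoDivisible_modTorsion_iff_sq (D : GenusPointData n) (hodd : Odd n) (h318 : D.lemma318)
    {X Y : D.H} (h : (curveA.baseChange D.H).toAffine.Nonsingular X Y) (hX0 : X ≠ 0) (hX2 : X ≠ 2 * D.im) :
    (∃ y : APoint D.H, IsOfFinAddOrder ((Point.some X Y h : APoint D.H) - (2 : ℤ) • y)) ↔
      ((∃ s : D.H, X = s ^ 2) ∧ ((∃ s : D.H, X - 2 * D.im = s ^ 2) ∨ ∃ s : D.H, (X - 2 * D.im) * D.im = s ^ 2)) ∨
        ((∃ s : D.H, X * D.im = s ^ 2) ∧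
          ((∃ s : D.H, (X - 2 * D.im) * (1 + D.im) = s ^ 2) ∨ ∃ s : D.H, (X - 2 * D.im) * (D.im * (1 + D.im)) = s ^ 2)) := by
  have hi0 := P2.ThetaDescent.im_ne_zero D
  obtain ⟨n1, -, -, -, n5, -, -, -, -⟩ := im_ne D
  have hX2' : X - 2 * D.im ≠ 0 := sub_ne_zero.mpr hX2
  rw [twoDivisible_modTorsion_iff_sqClass D hodd h318, twoDescentComponent_some_of_ne h hX0, sub_zero,
    twoDescentComponent_some_of_ne h hX2, sqClass_eq_one_iff hX0, sqClass_eq_one_iff hX2', sqClass_eq_iff_exists_sq hX0 hi0,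
    sqClass_eq_iff_exists_sq hX2' hi0, sqClass_eq_iff_exists_sq hX2' n1, sqClass_eq_iff_exists_sq hX2' n5]

/-! ## §3 LAW Z⁺ read through §2: the bit of LAW Z, and C⁺ on the visible rows off the cell -/

/-- ★★ **LAW Z⁺ ⟹ THE BIT.**  `n` odd, Lemma 3.18, `ζ₈ ∉ ℍ′_n` (`[i] ≠ 1`; for R2's `ℍ′ = ℚ(i, √l, √−q)` this is `√2 ∉ ℍ′`).  If the Kummer class of
`R ∈ A(ℍ′_n)` has the LAW Z⁺ shape — `[X(R)] = 1` and `[X(R) − 2i] ∈ {[c], [i·c]}` for some `c ≠ 0` — then **`R ∈ 2A(ℍ′_n) + tors ⟺ [c] ∈ {1, [i]}`**.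
[cite: SilvermanAEC2009, Prop. X.1.4] [cite: TianYuanZhang2017, Lemma 3.18 (p0017 L152–L153)] -/
theorem twoDivisible_iff_of_lawZPlus (D : GenusPointData n) (hodd : Odd n) (h318 : D.lemma318) (hi8 : sqClass D.im ≠ 1)
    (R : APoint D.H) {c : D.H} (hc : c ≠ 0)
    (hlaw : twoDescentComponent (curveA.baseChange D.H).toAffine 0 (2 * D.im) (-(2 * D.im)) R = 1 ∧
      (twoDescentComponent (curveA.baseChange D.H).toAffine (2 * D.im) 0 (-(2 * D.im)) R = sqClass c ∨
        twoDescentComponent (curveA.baseChange D.H).toAffine (2 * D.im) 0 (-(2 * D.im)) R = sqClass (D.im * c))) :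
    (∃ y : APoint D.H, IsOfFinAddOrder (R - (2 : ℤ) • y)) ↔ (sqClass c = 1 ∨ sqClass c = sqClass D.im) := by
  have hi0 := P2.ThetaDescent.im_ne_zero D
  have hic : sqClass (D.im * c) = sqClass D.im * sqClass c := sqClass_mul hi0 hc
  obtain ⟨h2, h1⟩ := hlaw
  rw [twoDivisible_modTorsion_iff_sqClass D hodd h318]
  constructor
  · rintro (⟨-, f1⟩ | ⟨f2, -⟩)
    · rcases h1 with e | e <;> rw [e] at f1
      · exact f1
      · rw [hic] at f1
        rcases f1 with f | f
        · right
          calc sqClass c = sqClass D.im * (sqClass D.im * sqClass c) := by rw [← mul_assoc, SqUnits.mul_self, SqUnits.one_mul]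
            _ = sqClass D.im := by rw [f, SqUnits.mul_one]
        · left
          calc sqClass c = sqClass D.im * (sqClass D.im * sqClass c) := by rw [← mul_assoc, SqUnits.mul_self, SqUnits.one_mul]
            _ = 1 := by rw [f, SqUnits.mul_self]
    · exact absurd (h2.symm.trans f2).symm hi8
  · intro hcl
    refine Or.inl ⟨h2, ?_⟩
    rcases h1 with e | e <;> rw [e]
    · exact hcl
    · rw [hic]
      rcases hcl with f | f <;> rw [f]
      · exact Or.inr (SqUnits.mul_one _)
      · exact Or.inl (SqUnits.mul_self _)

/-- ★★ **LAW Z⁺ ⟹ LAW Z's bit, cell by cell.**  `n` odd, Lemma 3.18, `[i] ≠ 1`; two elements `p, b ∈ ℍ′_n` whose classes `[p], [b], [pb]` avoid `{1, [i]}`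
(INDEPENDENCE — for R2: `p = π_l = a + bi`, `b = β_l = x + y√−q`; instrument: true on every row).  If the Kummer class of `R` is
`(1, [p^{e₁} b^{e₂}])` up to `[i]` (`e₁, e₂ ∈ {0,1}` — the LAW Z⁺ shape with `e₁ = [S = −1]`, `e₂ = [l ≠ x² + 32y²]`), then
**`R ∈ 2A(ℍ′_n) + tors ⟺ e₁ = 0 ∧ e₂ = 0`**. [cite: SilvermanAEC2009, Prop. X.1.4] [cite: TianYuanZhang2017, Lemma 3.18 (p0017 L152–L153)] -/
theorem twoDivisible_iff_cell_of_lawZPlus (D : GenusPointData n) (hodd : Odd n) (h318 : D.lemma318) (hi8 : sqClass D.im ≠ 1)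
    (R : APoint D.H) {p b : D.H} (hp0 : p ≠ 0) (hb0 : b ≠ 0)
    (hp : sqClass p ≠ 1 ∧ sqClass p ≠ sqClass D.im) (hb : sqClass b ≠ 1 ∧ sqClass b ≠ sqClass D.im)
    (hpb : sqClass (p * b) ≠ 1 ∧ sqClass (p * b) ≠ sqClass D.im) (e₁ e₂ : Bool)
    (hlaw : twoDescentComponent (curveA.baseChange D.H).toAffine 0 (2 * D.im) (-(2 * D.im)) R = 1 ∧
      (twoDescentComponent (curveA.baseChange D.H).toAffine (2 * D.im) 0 (-(2 * D.im)) R =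
          sqClass ((if e₁ then p else 1) * (if e₂ then b else 1)) ∨
        twoDescentComponent (curveA.baseChange D.H).toAffine (2 * D.im) 0 (-(2 * D.im)) R =
          sqClass (D.im * ((if e₁ then p else 1) * (if e₂ then b else 1))))) :
    (∃ y : APoint D.H, IsOfFinAddOrder (R - (2 : ℤ) • y)) ↔ (e₁ = false ∧ e₂ = false) := by
  have h11 : sqClass (1 : D.H) = 1 := by simpa using sqClass_sq (1 : D.H)
  have hc0 : (if e₁ then p else 1) * (if e₂ then b else 1) ≠ 0 :=
    mul_ne_zero (by split <;> simp [hp0]) (by split <;> simp [hb0])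
  rw [twoDivisible_iff_of_lawZPlus D hodd h318 hi8 R hc0 hlaw]
  cases e₁ <;> cases e₂ <;> simp only [Bool.false_eq_true, Bool.true_eq_false, if_false, if_true, one_mul, mul_one, and_true, and_false,
    and_self, iff_true, iff_false, not_or]
  · exact Or.inl h11
  · exact hb
  · exact hp
  · exact hpb

/-- ★★ **C⁺ AT `lq` ON A VISIBLE ROW OFF THE CELL, from LAW Z⁺.**  Granted conjuncts 1, 2, 4, 5 of 𝔅_ram; primes `l ≡ 1`, `q ≡ 7 (mod 8)`, `n = lq`,
`ord_{s=1} L(E_n, s) = 1`; a display package `D` (`Printed`, CM-point layer, Thm 3.5 at blocks) with `ζ₈ ∉ ℍ′_n`; a VISIBLE generator `h = (X, Y)` of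
`A_n(ℚ)` modulo torsion (`X ∉ 2ℚ^{×2}`); and LAW Z⁺ at the row in the displayed shape for the genus period `Z(n)` with independent `p, b` and
`(e₁, e₂) ≠ (0, 0)` (cells `S = −1` or `l ≠ x² + 32y²`: census 24 + 35 + 33 rows).  Then **`2 ∥ L` for every `L` with `𝓛(n)² = L²`** — by g26's
visible branch «C⁺ ⟺ `Z(lq) ∉ 2A(ℍ′) + tors`». [cite: TianYuanZhang2017, §1, §3.1, Thm. 3.5, Lemma 3.18, Thm. 1.2] [cite: BurungaleFlach2024, Thm 1.1 / Cor. 3]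
[cite: Darmon2004, Thm. 3.22] [cite: SilvermanAEC2009, Prop. X.1.4] -/
theorem levelTwo_of_lawZPlus_of_visible (hGZK : rank_eq_analyticRank_of_analyticRank_le_one)
    (hmod : WeierstrassCurve.hasEntireLFunction_rat) (hCM0 : bsdTriple_of_hasCM_of_L_one_ne_zero) (h12 : thm12_parity_of_scriptL')
    {l q : ℕ} (hl : l.Prime) (hq : q.Prime) (hl8 : l % 8 = 1) (hq8 : q % 8 = 7) (hn : n = l * q)
    (hr : (congruentNumberCurve n).analyticRank = 1)
    (D : GenusPointData n) (hPr : D.Printed) (hC : D.CMPointCompositumPrinted) (hBl : D.Thm35AtBlocks) (hi8 : sqClass D.im ≠ 1)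
    {X Y : ℚ} (h : (Atwo n).toAffine.Nonsingular X Y) (hX : ¬ ∃ s : ℚ, X = 2 * s ^ 2)
    (hgen : ∀ P : (Atwo n).toAffine.Point, ∃ m : ℤ, IsOfFinAddOrder (P - m • (Point.some X Y h : (Atwo n).toAffine.Point)))
    {p b : D.H} (hp0 : p ≠ 0) (hb0 : b ≠ 0)
    (hp : sqClass p ≠ 1 ∧ sqClass p ≠ sqClass D.im) (hb : sqClass b ≠ 1 ∧ sqClass b ≠ sqClass D.im)
    (hpb : sqClass (p * b) ≠ 1 ∧ sqClass (p * b) ≠ sqClass D.im) {e₁ e₂ : Bool} (hcell : ¬ (e₁ = false ∧ e₂ = false))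
    (hlaw : twoDescentComponent (curveA.baseChange D.H).toAffine 0 (2 * D.im) (-(2 * D.im)) (D.Z n) = 1 ∧
      (twoDescentComponent (curveA.baseChange D.H).toAffine (2 * D.im) 0 (-(2 * D.im)) (D.Z n) =
          sqClass ((if e₁ then p else 1) * (if e₂ then b else 1)) ∨
        twoDescentComponent (curveA.baseChange D.H).toAffine (2 * D.im) 0 (-(2 * D.im)) (D.Z n) =
          sqClass (D.im * ((if e₁ then p else 1) * (if e₂ then b else 1))))) :
    ∀ L : ℤ, IsScriptL n L → (2 : ℤ) ∣ L ∧ ¬ (4 : ℤ) ∣ L := by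
  have hodd : Odd n := by
    rw [hn, Nat.odd_mul]; exact ⟨Nat.odd_iff.mpr (by omega), Nat.odd_iff.mpr (by omega)⟩
  have h318 : D.lemma318 := hPr.2.2.2.2.2.2.2.2.1
  rw [GenusPeriodR2.levelTwo_iff_genusPeriod_not_twoDivisible_of_visible hGZK hmod hCM0 h12 hl hq hl8 hq8 hn hr D hPr hC hBl h hX hgen,
    twoDivisible_iff_cell_of_lawZPlus D hodd h318 hi8 (D.Z n) hp0 hb0 hp hb hpb e₁ e₂ hlaw]
  exact hcell

end Summit.BirchSwinnertonDyer.PrintCf2.GenusPeriodKummer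

end

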